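import Summits.QuantumFields.YangMills.Theorems.F4SubCurvatureDoorShortRootRigidityTrigonalDefs
import Summits.QuantumFields.YangMills.Theorems.F4SubCurvatureDoorShortRootRigidityTwoReflections
import Mathlib
import HarnessLib

/-!
# Trigonal Injectivity — STUB L4 `stub_finish` (the finish), BY NAME AND SIGNATURE

Sub-skeleton `Cruxes/ShortRootRigidity/Lines/trigonal_injectivity.lean` (planner ym-idea-3 g21, commit b8c4174ce46e), stub L4 (:153),
crux ⟨stmt-QuantumFields-23035⟩ `F4SubCurvatureDoor.ShortRootRigidity`, stub `:146 stub_oddModeRigidity` (algebraic half).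

`stub_finish (s) (hs : 1 ≤ s) (Y : P3) (hY : Y.IsHomogeneous (6*s)) (hh : lap Y = 0) (hO : OhInvariant Y) (hodd : bind₁ (linSubst Rf) Y = -Y) : Y = 0`
over the shared vocabulary of ✓`…ShortRootRigidityTrigonalDefs`.

PROOF (the owner's glue, 14:54:53Z, to w3 g38's ✓p726596 `eq_zero_of_odd_under_two_diagonal_reflections`): `σ`-oddness of `Y` is oddness
under the reflection `σ₁` in `(1,1,1)^⊥` (`Rf·x = σ₁ x`); conjugating by the sign flip `F` of the third coordinate (`σ₂ = F ∘ σ₁ ∘ F`, and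
`Y∘F = Y` by `O_h`-invariance) gives oddness under the reflection `σ₂` in `(1,1,−1)^⊥`; a real polynomial odd under both is `0`
(✓TwoReflections: zero on `Π₁`, invariant under the infinite-order rational rotation `σ₁σ₂` ⇒ zero on infinitely many planes ⇒ zero).
Degree, harmonicity and `s ≥ 1` are not needed (they are cleared at once).  Also recorded: `finish_holds : Finish s`.

Mathlib + tree only; no `sorry`.  HONEST LABEL: one of four stubs of a sub-skeleton of the OPEN stub `:146`; `OddModeRigidity`, ⟨23035⟩,
⟨23125⟩, R2d and the Yang–Mills mass gap remain OPEN; no summit is proved by a line.  Seat `ym-line-frs-p2` g16 (cell ym-idea-3, free hands).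
-/

noncomputable section

open MvPolynomial
open scoped BigOperators
open Literature.Algebra.Polynomial

namespace Summit.QuantumFields.YangMills.Theorems.F4SubCurvatureDoorTrigonalLine

open Summit.QuantumFields.YangMills.Theorems.F4SubCurvatureDoorTwoReflections (σ₁ σ₂ eq_zero_of_odd_under_two_diagonal_reflections)

/-! ## The two reflections in matrix form -/

/-- `Rf·x = σ₁ x` (the reflection in `(1,1,1)^⊥`). -/
theorem Rf_mulVec_eq_σ₁ (x : Fin 3 → ℝ) : Rf.mulVec x = σ₁ x := by
  ext i; fin_cases i <;> simp [Rf, J3, σ₁, Matrix.mulVec, dotProduct, Fin.sum_univ_three, Matrix.one_apply, Matrix.sub_apply] <;> ring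

/-- The sign flip of the third coordinate. -/
theorem flipMat_two_mulVec (x : Fin 3 → ℝ) : (flipMat 2).mulVec x = fun i => if i = 2 then -x i else x i := by
  ext i; fin_cases i <;> simp [flipMat, Matrix.mulVec_diagonal]

/-- `σ₂ = F ∘ σ₁ ∘ F` for the sign flip `F` of the third coordinate. -/
theorem σ₂_eq_conj (x : Fin 3 → ℝ) : σ₂ x = (flipMat 2).mulVec (σ₁ ((flipMat 2).mulVec x)) := by
  rw [flipMat_two_mulVec, flipMat_two_mulVec]
  ext i; fin_cases i <;> simp [σ₁, σ₂] <;> ring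

/-! ## Stub L4 -/

/-- STUB L4 (M−) — THE FINISH.  If `Y` is `σ`-odd then (transport by `O_h`) it is odd under the reflections in two diagonal planes,
hence invariant under their product `R`, a rational rotation about `e ∥ (−1,1,0)` with `cos α = −7/9` of infinite order
(`u_m = 9^m cos(mα)`, `u_{m+1} = −14u_m − 81u_{m−1}`, `u_m ≡ 2 (mod 3)` for `m ≥ 1`); so `Y` is zonal about `e`, by `O_h` zonal about
`(1,1,0)` too, hence `Y = c·(x²+y²+z²)^{3s}`, and harmonicity forces `c = 0`.  [§1-bis (7′), §1-ter (β)]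
PROVED here by w3 g38's ✓`eq_zero_of_odd_under_two_diagonal_reflections` (degree, harmonicity and `1 ≤ s` turn out to be unnecessary:
those binders are `_`-named; the statement's TYPE is the sub-skeleton's verbatim). -/
theorem stub_finish (s : ℕ) (_hs : 1 ≤ s) (Y : P3) (_hY : Y.IsHomogeneous (6 * s)) (_hh : lap Y = 0) (hO : OhInvariant Y)
    (hodd : bind₁ (linSubst Rf) Y = -Y) : Y = 0 := by
  -- the TYPE is the sub-skeleton's verbatim; the three idle hypotheses carry `_`-names (linter), binder names do not enter the statement
  have h₁ : ∀ x, eval (σ₁ x) Y = -eval x Y := by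
    intro x
    have h := congrArg (eval x) hodd
    rwa [eval_bind₁_linSubst, map_neg, Rf_mulVec_eq_σ₁] at h
  have hF : ∀ y, eval ((flipMat 2).mulVec y) Y = eval y Y := by
    intro y
    have h := congrArg (eval y) (hO.2 2)
    rwa [eval_bind₁_linSubst] at h
  refine eq_zero_of_odd_under_two_diagonal_reflections Y h₁ fun x => ?_
  rw [σ₂_eq_conj, hF, h₁, hF]

/-- **L4 as the Prop of the composition**: `Finish s` holds (for every `s`). -/
theorem finish_holds (s : ℕ) : Finish s :=
  fun hs Y hY hh hO hodd => stub_finish s hs Y hY hh hO hodd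

end Summit.QuantumFields.YangMills.Theorems.F4SubCurvatureDoorTrigonalLine

end
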